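import Summits.QuantumFields.YangMills.Theorems.SwapVirialDeficitGnomonicHistorySpeed
import Summits.QuantumFields.YangMills.Theorems.SwapVirialDeficitGnomonicDilation
import Summits.QuantumFields.YangMills.Theorems.SwapVirialDeficitBlowUpRingPathsParam
import Summits.QuantumFields.YangMills.Theorems.SwapVirialDeficitBlowUpGnomonicEulerJacobian
import Mathlib.Analysis.Calculus.FDeriv.Measurable
import HarnessLib

/-!
# The followers' virial identity (V2′, followers' half) for the σ-glued ring in the gnomonic product chart

(V2′) of fcl-p3 g45's virial SPEC (memo2 §2′): in the gnomonic product chart `η ∈ (ℝ³)^{Fol L}` of the followers (Haar = `(2π²)^{-|Fol|} Σ_ε ρ(η)dη`,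
✓`BlowUpRing.lintegral_haar_pi_eq_gnomonic`, `ρ = piWeight`), the blow-up is the LINEAR dilation `η ↦ e^s η`, and integration by parts for the Euler field
`X = Σ_i η_i·∂_{η_i}` against `e^{−bF̂}ρ` has NO boundary term (the chart is all of `(ℝ³)^{Fol L}`):

* §1 (generic, any finite index type `ι`): `hasDerivAt_exp_neg_mul_flow`; ★★ `virial_identity_of_flowDeriv` — for measurable `F ≥ 0` with an everywhere
  defined, measurable, bounded flow derivative `XF η = d/ds|₀ F(e^s η)` and `b ≥ 0`:
  `b·∫ (XF)·e^{−bF}·ρ = ∫ e^{−bF}·(3|ι| − Σ_i W(η_i))·ρ`, `W = gnomonicW ∈ [0,4)` (✓`integral_flowDeriv_mul_piWeight` at `g = e^{−bF}`);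
* §2 (the σ-glued ring, leaders FROZEN at any `C : Fin 4 → SU2`, signs `ε : Fol L → Bool`, `F̂(η) := chartDeficit L z χ (C, (quatToSU2 (gnoLetter ε_i η_i))_i)`):
  ★ `hasDerivAt_chartDeficit_followers_le` (`|d/ds F̂(e^s η)| ≤ 324·L⁴`, the frozen-leader twin of ✓`hasDerivAt_chartDeficit_gnomonic_le`),
  `contDiff_su2Quat_gnoLetter_comp`, ★ `contDiff_chartDeficit_followers_param` (✓`contDiff_chartDeficit_param` of LEAD g96), `continuous_chartDeficit_followers_flow`,
  `measurable_chartDeficit_followers`, ★ `measurable_flowDeriv_of_continuous` ∕ `measurable_flowDeriv_chartDeficit_followers` (✓Mathlib `measurable_deriv_with_param`; ✓`BlowUpRing.continuous_gnomonicW` of fcl-p3 g46),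
  `hasDerivAt_flowDeriv_chartDeficit_followers`, ★★★ `virial_followers` —
  `b·∫ (X F̂)·e^{−bF̂}·ρ dη = ∫ e^{−bF̂}·(3·|Fol L| − Σ_i W(η_i))·ρ dη` EXACTLY, every `L`, every `b ≥ 0`, every frozen leader tuple —
  and ★ `virial_followers_le`: `b·∫ (X F̂)·e^{−bF̂}·ρ ≤ 3·|Fol L|·∫ e^{−bF̂}·ρ`.
  The leaders' half (radial cone coordinates) and the sum over `ε` ∕ integration against the leader chart are separate bricks.

HONEST LABEL: an exact fixed-`L` identity (calculus ∕ IBP bookkeeping) for the window programme of a DRAFT line; it is NOT an estimate on ⟨24197⟩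
(window-uniform, OPEN) — the memo's (V4′) uniform moment bounds remain the open heart; ⟨24194⟩ ∕ ⟨24497⟩ OPEN; own crux ⟨22884⟩ OPEN (blocked-on ⟨19935⟩);
no crux, rung of record or summit is proved; the Yang–Mills mass gap is NOT proved; no summit is proved by a line.  THEOREMS ONLY (0 `def`, 0 `sorry`),
standard axioms.  Width seat ym-line-sfw-p2-w2 g57 (cell ym-idea-1, free hands), `--supports stmt-QuantumFields-24197`.  References: [cite: Luscher1983, §2];
[cite: Chatterjee2026YMHiggs, Lemma 5.1 (Haar on SU(2) in coordinates)]; [folklore].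
-/

set_option autoImplicit false

noncomputable section

open MeasureTheory
open Quaternion
open scoped Quaternion BigOperators
open Literature.MathematicalPhysics.QuantumLattice
open Literature.MathematicalPhysics.QuantumFieldTheory hiding SU2
open Summit.QuantumFields.YangMills.Theorems.FemtoTransferGap
open Summit.QuantumFields.YangMills.Theorems.FemtoTransferGap.TT
open Summit.QuantumFields.YangMills.Theorems.SwapVirialDeficit.BlowUp (qDeficit swapRingDeficit_eq_qDeficit)
open Summit.QuantumFields.YangMills.Theorems.SwapVirialDeficit.BlowUpRing

namespace Summit.QuantumFields.YangMills.Theorems.SwapVirialDeficit.Gnomonic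

variable {L : ℕ} [NeZero L]

/-! ## §1 Generic: the virial identity for the gnomonic product weight and ANY flow-differentiable `F ≥ 0` -/

section Generic

variable {ι : Type*} [Fintype ι]

omit [Fintype ι] in
/-- Chain rule: the flow derivative of `e^{−bF}` is `−b·(XF)·e^{−bF}`. [folklore] -/
theorem hasDerivAt_exp_neg_mul_flow {F XF : (ι → Fin 3 → ℝ) → ℝ} (b : ℝ) (hX : ∀ η, HasDerivAt (fun s : ℝ => F (Real.exp s • η)) (XF η) 0)
    (η : ι → Fin 3 → ℝ) :
    HasDerivAt (fun s : ℝ => Real.exp (-b * F (Real.exp s • η))) (-b * XF η * Real.exp (-b * F η)) 0 := by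
  have h := ((hX η).const_mul (-b)).exp
  simp only [Real.exp_zero, one_smul] at h
  convert h using 1
  ring

/-- ★★ **THE VIRIAL IDENTITY FOR THE GNOMONIC PRODUCT WEIGHT** (generic form): for a measurable `F ≥ 0` on `(ℝ³)^ι` whose dilation-flow derivative
`XF η = d/ds|₀ F(e^s η)` exists everywhere, is measurable and bounded, and every `b ≥ 0`,
`b · ∫ (XF)·e^{−bF}·ρ = ∫ e^{−bF}·(3|ι| − Σ_i W(η_i))·ρ`, `ρ = piWeight`, `W = gnomonicW` (✓`integral_flowDeriv_mul_piWeight` at `g = e^{−bF}`).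
[cite: Luscher1983, §2] -/
theorem virial_identity_of_flowDeriv {F XF : (ι → Fin 3 → ℝ) → ℝ} (hF : Measurable F) (h0 : ∀ η, 0 ≤ F η)
    (hX : ∀ η, HasDerivAt (fun s : ℝ => F (Real.exp s • η)) (XF η) 0) (hXm : Measurable XF) {M : ℝ} (hXbd : ∀ η, |XF η| ≤ M)
    {b : ℝ} (hb : 0 ≤ b) :
    b * ∫ η : ι → Fin 3 → ℝ, XF η * (Real.exp (-b * F η) * piWeight η) =
      ∫ η : ι → Fin 3 → ℝ, Real.exp (-b * F η) * ((3 * (Fintype.card ι : ℝ) - ∑ i, gnomonicW (η i)) * piWeight η) := by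
  have hg : Measurable fun η => Real.exp (-b * F η) := Real.measurable_exp.comp (hF.const_mul _)
  have hbd : ∀ η, |Real.exp (-b * F η)| ≤ 1 := fun η => by
    rw [abs_of_pos (Real.exp_pos _)]
    exact Real.exp_le_one_iff.2 (by nlinarith [h0 η])
  have hM : 0 ≤ M := (abs_nonneg _).trans (hXbd fun _ _ => 0)
  have hXg := hasDerivAt_exp_neg_mul_flow b hX
  have hXgm : Measurable fun η => -b * XF η * Real.exp (-b * F η) := (hXm.const_mul _).mul hg
  have hXgbd : ∀ η, |-b * XF η * Real.exp (-b * F η)| ≤ b * M := fun η => by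
    rw [abs_mul, abs_mul, abs_neg, abs_of_nonneg hb]
    calc b * |XF η| * |Real.exp (-b * F η)| ≤ b * M * 1 :=
          mul_le_mul (mul_le_mul_of_nonneg_left (hXbd η) hb) (hbd η) (abs_nonneg _) (mul_nonneg hb hM)
      _ = b * M := mul_one _
  have key := integral_flowDeriv_mul_piWeight hg hbd hXg hXgm hXgbd
  have e1 : ∫ η : ι → Fin 3 → ℝ, -b * XF η * Real.exp (-b * F η) * piWeight η =
      -b * ∫ η : ι → Fin 3 → ℝ, XF η * (Real.exp (-b * F η) * piWeight η) := by
    rw [← integral_const_mul]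
    congr 1
    funext η
    ring
  have e2 : ∫ η : ι → Fin 3 → ℝ, Real.exp (-b * F η) * (((∑ i, gnomonicW (η i)) - 3 * (Fintype.card ι : ℝ)) * piWeight η) =
      -∫ η : ι → Fin 3 → ℝ, Real.exp (-b * F η) * ((3 * (Fintype.card ι : ℝ) - ∑ i, gnomonicW (η i)) * piWeight η) := by
    rw [← integral_neg]
    congr 1
    funext η
    ring
  rw [e1, e2] at key
  linarith

/-- ★ The flow derivative `η ↦ d/ds|₀ F(e^s η)` of a CONTINUOUS `F` is measurable (✓Mathlib `measurable_deriv_with_param`: `(η, s) ↦ F(e^s η)` is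
jointly continuous). [folklore] -/
theorem measurable_flowDeriv_of_continuous {F : (ι → Fin 3 → ℝ) → ℝ} (hF : Continuous F) :
    Measurable fun η : ι → Fin 3 → ℝ => deriv (fun s : ℝ => F (Real.exp s • η)) 0 := by
  have hc : Continuous (Function.uncurry fun (η : ι → Fin 3 → ℝ) (s : ℝ) => F (Real.exp s • η)) :=
    hF.comp ((Real.continuous_exp.comp continuous_snd).smul continuous_fst)
  have hm : Measurable fun p : (ι → Fin 3 → ℝ) × ℝ => deriv (fun s : ℝ => F (Real.exp s • p.1)) p.2 := measurable_deriv_with_param hc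
  exact hm.comp (measurable_id.prodMk measurable_const)

end Generic

/-! ## §2 The σ-glued deficit with FROZEN leaders along the followers' gnomonic dilation flow -/

section Followers

/-- ★ Speed bound with frozen leaders: for any `C : Fin 4 → SU2`, signs `ε`, coordinates `η`, and every `s`,
`|d/ds chartDeficit L z χ (C, (quatToSU2 (gnoLetter ε_i (e^s η_i)))_i)| ≤ 324·L⁴` (✓`speed_const`, ✓`hasDerivAt_smulLetter`, ✓`speed_fixHistory`,
✓`hasDerivAt_qDeficit_le` at `M = 3`, ✓`swapRingDeficit_eq_qDeficit`). [cite: Luscher1983, §2] -/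
theorem hasDerivAt_chartDeficit_followers_le (z : Fin 3 → Bool) (χ : Site 3 L → SU2) (C : Fin 4 → SU2) (ε : Fol L → Bool)
    (η : Fol L → Fin 3 → ℝ) (s : ℝ) :
    ∃ d : ℝ, HasDerivAt (fun s : ℝ => chartDeficit L z χ (C, fun i => quatToSU2 (gnoLetter (ε i) ((Real.exp s • η) i)))) d s ∧
      |d| ≤ 324 * (L : ℝ) ^ 4 := by
  have hC : ∀ μ : Fin 4, ∃ D : ℍ, HasDerivAt (fun _ : ℝ => su2Quat (C μ)) D s ∧ ‖D‖ ≤ 1 := fun μ => speed_const (s := s) _ zero_le_one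
  have hU : ∀ i : Fol L, ∃ D : ℍ, HasDerivAt (fun s : ℝ => su2Quat (quatToSU2 (gnoLetter (ε i) ((Real.exp s • η) i)))) D s ∧ ‖D‖ ≤ 1 :=
    fun i => by
      obtain ⟨D, hD, hle⟩ := hasDerivAt_smulLetter (ε i) (η i) s
      exact ⟨D, by simpa only [Pi.smul_apply] using hD, hle.trans (by norm_num)⟩
  obtain ⟨h1, h2⟩ := speed_fixHistory (C := fun _ : ℝ => C) (U := fun s i => quatToSU2 (gnoLetter (ε i) ((Real.exp s • η) i))) χ hC hU
  have h := hasDerivAt_qDeficit_le (L := L) z (s := s) (M := 3) (by norm_num)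
    (Q := fun s => ((fun (j : Fin (2 * L - 1 + 1)) (e : Edge 3 L) =>
        su2Quat ((fixHistory (ringConfig χ (C, fun i => quatToSU2 (gnoLetter (ε i) ((Real.exp s • η) i))))).1 j e)),
      fun x : Site 3 L => su2Quat ((fixHistory (ringConfig χ (C, fun i => quatToSU2 (gnoLetter (ε i) ((Real.exp s • η) i))))).2 x)))
    (fun j e => h1 j e) (fun x => h2 x) (fun j e => (norm_su2Quat _).le) (fun x => (norm_su2Quat _).le)
  obtain ⟨d, hd, hle⟩ := h
  refine ⟨d, ?_, hle.trans (by nlinarith [pow_nonneg (Nat.cast_nonneg L : (0:ℝ) ≤ L) 4])⟩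
  have e : (fun s : ℝ => chartDeficit L z χ (C, fun i => quatToSU2 (gnoLetter (ε i) ((Real.exp s • η) i)))) = fun s => qDeficit z
      ((fun (j : Fin (2 * L - 1 + 1)) (e : Edge 3 L) =>
        su2Quat ((fixHistory (ringConfig χ (C, fun i => quatToSU2 (gnoLetter (ε i) ((Real.exp s • η) i))))).1 j e)),
      fun x : Site 3 L => su2Quat ((fixHistory (ringConfig χ (C, fun i => quatToSU2 (gnoLetter (ε i) ((Real.exp s • η) i))))).2 x)) :=
    funext fun s => swapRingDeficit_eq_qDeficit z _
  rw [e]; exact hd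

/-- A normalised gnomonic letter `p ↦ su2Quat (quatToSU2 (gnoLetter ε (φ p)))` is `C^n` in any `C^n` parameter `φ` (✓`contDiff_su2Quat_quatToSU2_comp`,
✓`contDiff_gnoLetter`, ✓`gnoLetter_ne_zero`). [folklore] -/
theorem contDiff_su2Quat_gnoLetter_comp {E : Type*} [NormedAddCommGroup E] [NormedSpace ℝ E] {n : ℕ∞} (ε : Bool) {φ : E → Fin 3 → ℝ}
    (hφ : ContDiff ℝ n φ) : ContDiff ℝ n (fun p => su2Quat (quatToSU2 (gnoLetter ε (φ p)))) :=
  contDiff_su2Quat_quatToSU2_comp ((contDiff_gnoLetter ε).comp hφ) (fun _ => gnoLetter_ne_zero ε _)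

/-- ★ The frozen-leader deficit is `C^n` in any `C^n` follower-coordinate parameter (✓`contDiff_chartDeficit_param`). [cite: Luscher1983, §2] -/
theorem contDiff_chartDeficit_followers_param {E : Type*} [NormedAddCommGroup E] [NormedSpace ℝ E] {n : ℕ∞} (z : Fin 3 → Bool) (χ : Site 3 L → SU2)
    (C : Fin 4 → SU2) (ε : Fol L → Bool) {φ : E → Fol L → Fin 3 → ℝ} (hφ : ContDiff ℝ n φ) :
    ContDiff ℝ n (fun p => chartDeficit L z χ (C, fun i => quatToSU2 (gnoLetter (ε i) (φ p i)))) :=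
  contDiff_chartDeficit_param (C := fun _ => C) (U := fun p i => quatToSU2 (gnoLetter (ε i) (φ p i))) z χ (fun _ => contDiff_const)
    (fun i => contDiff_su2Quat_gnoLetter_comp (ε i) (contDiff_pi.1 hφ i))

/-- The frozen-leader deficit is continuous JOINTLY in `(η, s)` along the flow `η ↦ e^s η`. [folklore] -/
theorem continuous_chartDeficit_followers_flow (z : Fin 3 → Bool) (χ : Site 3 L → SU2) (C : Fin 4 → SU2) (ε : Fol L → Bool) :
    Continuous (Function.uncurry fun (η : Fol L → Fin 3 → ℝ) (s : ℝ) =>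
      chartDeficit L z χ (C, fun i => quatToSU2 (gnoLetter (ε i) ((Real.exp s • η) i)))) :=
  (contDiff_chartDeficit_followers_param (n := 0) z χ C ε (φ := fun p : (Fol L → Fin 3 → ℝ) × ℝ => Real.exp p.2 • p.1)
    ((Real.contDiff_exp.comp contDiff_snd).smul contDiff_fst)).continuous

/-- The frozen-leader deficit is measurable in `η`. [folklore] -/
theorem measurable_chartDeficit_followers (z : Fin 3 → Bool) (χ : Site 3 L → SU2) (C : Fin 4 → SU2) (ε : Fol L → Bool) :
    Measurable fun η : Fol L → Fin 3 → ℝ => chartDeficit L z χ (C, fun i => quatToSU2 (gnoLetter (ε i) (η i))) :=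
  (contDiff_chartDeficit_followers_param (n := 0) z χ C ε (φ := fun η : Fol L → Fin 3 → ℝ => η) contDiff_id).continuous.measurable

/-- ★ The flow derivative `η ↦ d/ds|₀ F̂(e^s η)` of the frozen-leader deficit is MEASURABLE (✓`measurable_deriv_with_param` — continuity in `(η, s)`).
[folklore] -/
theorem measurable_flowDeriv_chartDeficit_followers (z : Fin 3 → Bool) (χ : Site 3 L → SU2) (C : Fin 4 → SU2) (ε : Fol L → Bool) :
    Measurable fun η : Fol L → Fin 3 → ℝ =>
      deriv (fun s : ℝ => chartDeficit L z χ (C, fun i => quatToSU2 (gnoLetter (ε i) ((Real.exp s • η) i)))) 0 :=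
  measurable_flowDeriv_of_continuous (F := fun η : Fol L → Fin 3 → ℝ => chartDeficit L z χ (C, fun i => quatToSU2 (gnoLetter (ε i) (η i))))
    (contDiff_chartDeficit_followers_param (n := 0) z χ C ε (φ := fun η : Fol L → Fin 3 → ℝ => η) contDiff_id).continuous

/-- The flow derivative exists at `s = 0` (as `deriv`) and is bounded by `324·L⁴`. [cite: Luscher1983, §2] -/
theorem hasDerivAt_flowDeriv_chartDeficit_followers (z : Fin 3 → Bool) (χ : Site 3 L → SU2) (C : Fin 4 → SU2) (ε : Fol L → Bool)
    (η : Fol L → Fin 3 → ℝ) :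
    HasDerivAt (fun s : ℝ => chartDeficit L z χ (C, fun i => quatToSU2 (gnoLetter (ε i) ((Real.exp s • η) i))))
        (deriv (fun s : ℝ => chartDeficit L z χ (C, fun i => quatToSU2 (gnoLetter (ε i) ((Real.exp s • η) i)))) 0) 0 ∧
      |deriv (fun s : ℝ => chartDeficit L z χ (C, fun i => quatToSU2 (gnoLetter (ε i) ((Real.exp s • η) i)))) 0| ≤ 324 * (L : ℝ) ^ 4 := by
  obtain ⟨d, hd, hle⟩ := hasDerivAt_chartDeficit_followers_le z χ C ε η 0
  rw [hd.deriv]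
  exact ⟨hd, hle⟩

/-- ★★★ **THE FOLLOWERS' VIRIAL IDENTITY (V2′, followers' half) FOR THE σ-GLUED RING**: leaders frozen at any `C : Fin 4 → SU2`, hemisphere signs `ε`,
sector `z`, character `χ`, every `b ≥ 0`; with `F̂(η) := chartDeficit L z χ (C, (quatToSU2 (gnoLetter ε_i η_i))_i)` and `X F̂ (η) := d/ds|₀ F̂(e^s η)`:
`b · ∫ (X F̂)·e^{−bF̂}·ρ dη = ∫ e^{−bF̂}·(3·|Fol L| − Σ_i W(η_i))·ρ dη` on `(ℝ³)^{Fol L}`, `ρ = piWeight`, `W = gnomonicW ∈ [0, 4)` —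
EXACT at every `L`, no boundary ∕ flux term (the chart is all of `(ℝ³)^{Fol L}`).  [cite: Luscher1983, §2] -/
theorem virial_followers (z : Fin 3 → Bool) (χ : Site 3 L → SU2) (C : Fin 4 → SU2) (ε : Fol L → Bool) {b : ℝ} (hb : 0 ≤ b) :
    b * ∫ η : Fol L → Fin 3 → ℝ,
        deriv (fun s : ℝ => chartDeficit L z χ (C, fun i => quatToSU2 (gnoLetter (ε i) ((Real.exp s • η) i)))) 0 *
          (Real.exp (-b * chartDeficit L z χ (C, fun i => quatToSU2 (gnoLetter (ε i) (η i)))) * piWeight η) =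
      ∫ η : Fol L → Fin 3 → ℝ, Real.exp (-b * chartDeficit L z χ (C, fun i => quatToSU2 (gnoLetter (ε i) (η i)))) *
        ((3 * (Fintype.card (Fol L) : ℝ) - ∑ i, gnomonicW (η i)) * piWeight η) :=
  virial_identity_of_flowDeriv (F := fun η : Fol L → Fin 3 → ℝ => chartDeficit L z χ (C, fun i => quatToSU2 (gnoLetter (ε i) (η i))))
    (XF := fun η => deriv (fun s : ℝ => chartDeficit L z χ (C, fun i => quatToSU2 (gnoLetter (ε i) ((Real.exp s • η) i)))) 0)
    (measurable_chartDeficit_followers z χ C ε) (fun _ => chartDeficit_nonneg z χ _)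
    (fun η => (hasDerivAt_flowDeriv_chartDeficit_followers z χ C ε η).1) (measurable_flowDeriv_chartDeficit_followers z χ C ε)
    (fun η => (hasDerivAt_flowDeriv_chartDeficit_followers z χ C ε η).2) hb

/-- ★ Corollary (the virial INEQUALITY used downstream): since `0 ≤ W`, `b · ∫ (X F̂)·e^{−bF̂}·ρ ≤ 3·|Fol L| · ∫ e^{−bF̂}·ρ`. [cite: Luscher1983, §2] -/
theorem virial_followers_le (z : Fin 3 → Bool) (χ : Site 3 L → SU2) (C : Fin 4 → SU2) (ε : Fol L → Bool) {b : ℝ} (hb : 0 ≤ b) :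
    b * ∫ η : Fol L → Fin 3 → ℝ,
        deriv (fun s : ℝ => chartDeficit L z χ (C, fun i => quatToSU2 (gnoLetter (ε i) ((Real.exp s • η) i)))) 0 *
          (Real.exp (-b * chartDeficit L z χ (C, fun i => quatToSU2 (gnoLetter (ε i) (η i)))) * piWeight η) ≤
      3 * (Fintype.card (Fol L) : ℝ) *
        ∫ η : Fol L → Fin 3 → ℝ, Real.exp (-b * chartDeficit L z χ (C, fun i => quatToSU2 (gnoLetter (ε i) (η i)))) * piWeight η := by
  rw [virial_followers z χ C ε hb, ← integral_const_mul]
  have hFm := measurable_chartDeficit_followers z χ C ε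
  have hEm : Measurable fun η : Fol L → Fin 3 → ℝ => Real.exp (-b * chartDeficit L z χ (C, fun i => quatToSU2 (gnoLetter (ε i) (η i)))) :=
    Real.measurable_exp.comp (hFm.const_mul _)
  have hE1 : ∀ η : Fol L → Fin 3 → ℝ, |Real.exp (-b * chartDeficit L z χ (C, fun i => quatToSU2 (gnoLetter (ε i) (η i))))| ≤ 1 := fun η => by
    rw [abs_of_pos (Real.exp_pos _)]
    exact Real.exp_le_one_iff.2 (by nlinarith [chartDeficit_nonneg z χ (C, fun i => quatToSU2 (gnoLetter (ε i) (η i)))])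
  have hWm : Measurable fun η : Fol L → Fin 3 → ℝ => ∑ i, gnomonicW (η i) :=
    (continuous_finsetSum _ fun i _ => BlowUpRing.continuous_gnomonicW.comp (continuous_apply i)).measurable
  have hW : ∀ η : Fol L → Fin 3 → ℝ, 0 ≤ ∑ i, gnomonicW (η i) ∧ ∑ i, gnomonicW (η i) ≤ 4 * (Fintype.card (Fol L) : ℝ) := fun η =>
    ⟨Finset.sum_nonneg fun i _ => (gnomonicW_nonneg_le (η i)).1,
      (Finset.sum_le_sum fun i _ => (gnomonicW_nonneg_le (η i)).2).trans
        (le_of_eq (by rw [Finset.sum_const, Finset.card_univ, nsmul_eq_mul, mul_comm]))⟩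
  have hi : Integrable (fun η : Fol L → Fin 3 → ℝ =>
      Real.exp (-b * chartDeficit L z χ (C, fun i => quatToSU2 (gnoLetter (ε i) (η i)))) * piWeight η) :=
    (integrable_piWeight (ι := Fol L)).mono (hEm.mul continuous_piWeight.measurable).aestronglyMeasurable
      (Filter.Eventually.of_forall fun η => by
        rw [Real.norm_eq_abs, Real.norm_eq_abs, abs_mul, abs_of_nonneg (piWeight_pos η).le]
        exact mul_le_of_le_one_left (piWeight_pos η).le (hE1 η))
  have hj : Integrable (fun η : Fol L → Fin 3 → ℝ =>
      Real.exp (-b * chartDeficit L z χ (C, fun i => quatToSU2 (gnoLetter (ε i) (η i)))) *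
        ((3 * (Fintype.card (Fol L) : ℝ) - ∑ i, gnomonicW (η i)) * piWeight η)) :=
    ((integrable_piWeight (ι := Fol L)).const_mul (7 * (Fintype.card (Fol L) : ℝ))).mono
      (hEm.mul ((measurable_const.sub hWm).mul continuous_piWeight.measurable)).aestronglyMeasurable
      (Filter.Eventually.of_forall fun η => by
        rw [Real.norm_eq_abs, Real.norm_eq_abs, abs_mul, abs_mul, abs_mul, abs_of_nonneg (piWeight_pos η).le,
          abs_of_nonneg (by positivity : (0:ℝ) ≤ 7 * (Fintype.card (Fol L) : ℝ))]
        have h3 : |3 * (Fintype.card (Fol L) : ℝ) - ∑ i, gnomonicW (η i)| ≤ 7 * (Fintype.card (Fol L) : ℝ) :=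
          abs_le.2 ⟨by nlinarith [(hW η).1, (hW η).2], by nlinarith [(hW η).1, (hW η).2]⟩
        calc |Real.exp (-b * chartDeficit L z χ (C, fun i => quatToSU2 (gnoLetter (ε i) (η i))))| *
              (|3 * (Fintype.card (Fol L) : ℝ) - ∑ i, gnomonicW (η i)| * piWeight η)
            ≤ 1 * (7 * (Fintype.card (Fol L) : ℝ) * piWeight η) :=
              mul_le_mul (hE1 η) (mul_le_mul_of_nonneg_right h3 (piWeight_pos η).le) (mul_nonneg (abs_nonneg _) (piWeight_pos η).le) zero_le_one
          _ = 7 * (Fintype.card (Fol L) : ℝ) * piWeight η := one_mul _)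
  refine integral_mono hj (hi.const_mul _) fun η => ?_
  have hρ := (piWeight_pos η).le
  have hE := (Real.exp_pos (-b * chartDeficit L z χ (C, fun i => quatToSU2 (gnoLetter (ε i) (η i))))).le
  show Real.exp (-b * chartDeficit L z χ (C, fun i => quatToSU2 (gnoLetter (ε i) (η i)))) *
      ((3 * (Fintype.card (Fol L) : ℝ) - ∑ i, gnomonicW (η i)) * piWeight η) ≤
    3 * (Fintype.card (Fol L) : ℝ) * (Real.exp (-b * chartDeficit L z χ (C, fun i => quatToSU2 (gnoLetter (ε i) (η i)))) * piWeight η)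
  nlinarith [mul_nonneg hE (mul_nonneg (hW η).1 hρ)]

end Followers

end Summit.QuantumFields.YangMills.Theorems.SwapVirialDeficit.Gnomonic

end
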